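import Mathlib

/-!
# `PhaseMomentSplit` — HEART: §0 (the dial) + §4 (the decided heart), split off for the 400-line lint

(decomp-langlands cell.  Census-1 g32 PRE-CUT of the lens-4 g34 Theorems twin `landing/PhaseMomentSplit.lean`
(sha256 `27985f3a5d43cb04…`, 559 l) following the kit's RUNME §2: «split §4 `section Heart` into `PhaseMomentSplitHeart.lean`
(imports only Mathlib-level facts + nothing of §1–§3) and import it».  THIS file = §0 (`PhaseSupport`, `stMoment`, `quartic`,
`PhaseMomentCertificate`) + §4 (`section Heart`) of the twin VERBATIM under `import Mathlib`; the companion module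
`Theorems.PhaseMomentSplit` = the node's module docstring + §1–§3 verbatim, importing this one.  Same namespace
`Summit.Langlands.Langlands.Theorems.PhaseMomentSplit`; no declaration text was changed.)
-/

set_option linter.dupNamespace false
set_option linter.style.longLine false


noncomputable section

namespace Summit.Langlands.Langlands.Theorems.PhaseMomentSplit


open scoped BigOperators Topology Matrix Classical NumberField Polynomial
open Filter Set Function

/-! ## §0 The dial: a phase-moment certificate of the layer group (pure finite-group / real-algebra data) -/

/-- [new] **Phase support of order `f`.**  `x : ℝ` is an admissible value of the ADJOINT TRACE `X = t₁/t₂ + 1 + t₂/t₁` of the Satake pair of `π`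
at a place whose Frobenius has order `f` in the layer group and is INERT in the quadratic field `M` from which the candidate is induced:
`x = 1 − ζ − ζ⁻¹` with `ζ^f = 1` (`ζ = −t₁/t₂`; kernel `phase_of_powers`).  `V_f := {1 − 2cos(2πk/f)} ⊂ [−1, 3]`. -/
def PhaseSupport (f : ℕ) (x : ℝ) : Prop := ∃ ζ : ℂ, ζ ^ f = 1 ∧ (x : ℂ) = 1 - ζ - ζ⁻¹

/-- [new] The `SO(3)` SATO–TATE MOMENTS `E[X^j] = 1, 0, 1, 1, 3` (`j = 0,…,4`) of `X = 1 + 2cos θ` — on the automorphic side they are READ OFF the six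
Jacquet–Shalika pole orders of `L^S(s, Π × Π')`, `Π, Π' ∈ {1, ad π, A⁴π}` (kernel `stMoment_of_poles`). -/
def stMoment : Fin 5 → ℝ := ![1, 0, 1, 1, 3]

/-- Evaluation of the real quartic with coefficient vector `p`. -/
def quartic (p : Fin 5 → ℝ) (x : ℝ) : ℝ := ∑ j : Fin 5, p j * x ^ (j : ℕ)

/-- [new] **`PhaseMomentCertificate G`** — a PHASE-MOMENT CERTIFICATE of the (layer) group `G`: a real quartic `P = Σ p_j x^j` and per-order constants
`κ_f` with `κ_{ord g} ≤ P` on the phase support `V_{ord g}` for every `g ∈ G`, whose class average STRICTLY BEATS the Sato–Tate pairing of `P`: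
`(Σ_j p_j m_j) · |G| < Σ_{g ∈ G} κ_{ord g}`.  Depends on `G` only through its ORDER STATISTICS; `0 < Nat.card G` makes it FALSE for infinite `G` (no junk truth; layer groups are finite);
decided for the icosahedral class by `cert_of_orderOf_le_five`; an LP in `5 + #ord(G)` variables in general (instrument I-g34.1). -/
def PhaseMomentCertificate (G : Type*) [Group G] : Prop :=
  ∃ (p : Fin 5 → ℝ) (κ : ℕ → ℝ), 0 < Nat.card G ∧ (∀ g : G, ∀ x : ℝ, PhaseSupport (orderOf g) x → κ (orderOf g) ≤ quartic p x) ∧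
    (∑ j : Fin 5, p j * stMoment j) * (Nat.card G : ℝ) < ∑ᶠ g : G, κ (orderOf g)

/-! ## §4 The decided heart (kernel-certified): phase supports, the certificate of the icosahedral class, and the moment bookkeeping -/

section Heart

/-! ### Root-of-unity identities: the phase support of order `f ≤ 5` is cut out by an integer polynomial -/

/-- A root of unity is non-zero (`ζ ^ f = 1`, `f ≠ 0` ⇒ `ζ ≠ 0`). [folklore; docstring added by the census twin — gate lint] -/
theorem ne_zero_of_pow_eq_one {ζ : ℂ} {f : ℕ} (hf : f ≠ 0) (h : ζ ^ f = 1) : ζ ≠ 0 := by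
  rintro rfl; rw [zero_pow hf] at h; exact zero_ne_one h

/-- cancellation of the unit `ζ^n` in the root-of-unity identities below -/
theorem eq_zero_of_unit_mul {ζ a b : ℂ} {n : ℕ} (hz : ζ ≠ 0) (h : ζ ^ n * a = b) (hb : b = 0) : a = 0 :=
  (mul_eq_zero.mp (h.trans hb)).resolve_left (pow_ne_zero _ hz)

/-- The phase support of order `1` is `{-1}`: `ζ = 1` gives `x = 1 - ζ - ζ⁻¹ = -1`. [folklore; docstring added by the census twin] -/
theorem support_one {x : ℝ} (h : PhaseSupport 1 x) : x = -1 := by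
  obtain ⟨ζ, hζ, hx⟩ := h
  rw [pow_one] at hζ; subst hζ
  have : (x : ℂ) = -1 := by rw [hx]; norm_num
  exact_mod_cast this

/-- `ζ² = 1`:  `ζ²·(x+1)(x−3) = (ζ²−1)²`. -/
theorem support_two {x : ℝ} (h : PhaseSupport 2 x) : (x + 1) * (x - 3) = 0 := by
  obtain ⟨ζ, hζ, hx⟩ := h
  have hz : ζ ≠ 0 := ne_zero_of_pow_eq_one two_ne_zero hζ
  have key : ζ ^ 2 * (((x : ℂ) + 1) * ((x : ℂ) - 3)) = (ζ ^ 2 - 1) ^ 2 := by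
    rw [hx]; field_simp; ring
  have := eq_zero_of_unit_mul hz key (by rw [hζ]; ring)
  exact_mod_cast this

/-- `ζ³ = 1`:  `ζ²·(x+1)(x−2) = (ζ−1)(ζ³−1)`. -/
theorem support_three {x : ℝ} (h : PhaseSupport 3 x) : (x + 1) * (x - 2) = 0 := by
  obtain ⟨ζ, hζ, hx⟩ := h
  have hz : ζ ≠ 0 := ne_zero_of_pow_eq_one three_ne_zero hζ
  have key : ζ ^ 2 * (((x : ℂ) + 1) * ((x : ℂ) - 2)) = (ζ - 1) * (ζ ^ 3 - 1) := by
    rw [hx]; field_simp; ring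
  have := eq_zero_of_unit_mul hz key (by rw [hζ]; ring)
  exact_mod_cast this

/-- `ζ⁴ = 1`:  `ζ³·(x+1)(x−1)(x−3) = −(ζ²−1)(ζ⁴−1)`. -/
theorem support_four {x : ℝ} (h : PhaseSupport 4 x) : (x + 1) * (x - 1) * (x - 3) = 0 := by
  obtain ⟨ζ, hζ, hx⟩ := h
  have hz : ζ ≠ 0 := ne_zero_of_pow_eq_one four_ne_zero hζ
  have key : ζ ^ 3 * (((x : ℂ) + 1) * ((x : ℂ) - 1) * ((x : ℂ) - 3)) = -((ζ ^ 2 - 1) * (ζ ^ 4 - 1)) := by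
    rw [hx]; field_simp; ring
  have := eq_zero_of_unit_mul hz key (by rw [hζ]; ring)
  exact_mod_cast this

/-- `ζ⁵ = 1`:  `ζ³·(x+1)(x²−3x+1) = −(ζ−1)(ζ⁵−1)`  (`ζ²(x²−3x+1) = Φ₅(ζ)`). -/
theorem support_five {x : ℝ} (h : PhaseSupport 5 x) : (x + 1) * (x ^ 2 - 3 * x + 1) = 0 := by
  obtain ⟨ζ, hζ, hx⟩ := h
  have hz : ζ ≠ 0 := ne_zero_of_pow_eq_one (by norm_num) hζ
  have key : ζ ^ 3 * (((x : ℂ) + 1) * ((x : ℂ) ^ 2 - 3 * (x : ℂ) + 1)) = -((ζ - 1) * (ζ ^ 5 - 1)) := by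
    rw [hx]; field_simp; ring
  have := eq_zero_of_unit_mul hz key (by rw [hζ]; ring)
  exact_mod_cast this

/-- `ζ⁶ = 1`:  `ζ⁴·(x+1)x(x−2)(x−3) = (ζ²−1)(ζ⁶−1)`  (`ζx = −Φ₆(ζ)`, `ζ(x−2) = −Φ₃(ζ)`). -/
theorem support_six {x : ℝ} (h : PhaseSupport 6 x) : (x + 1) * x * (x - 2) * (x - 3) = 0 := by
  obtain ⟨ζ, hζ, hx⟩ := h
  have hz : ζ ≠ 0 := ne_zero_of_pow_eq_one (by norm_num) hζ
  have key : ζ ^ 4 * (((x : ℂ) + 1) * (x : ℂ) * ((x : ℂ) - 2) * ((x : ℂ) - 3)) = (ζ ^ 2 - 1) * (ζ ^ 6 - 1) := by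
    rw [hx]; field_simp; ring
  have := eq_zero_of_unit_mul hz key (by rw [hζ]; ring)
  exact_mod_cast this

/-- `ζ¹⁰ = 1`:  `ζ⁶·(x+1)(x−3)(x²−3x+1)(x²−x−1) = (ζ²−1)(ζ¹⁰−1)`  (`ζ²(x²−x−1) = Φ₁₀(ζ)`). -/
theorem support_ten {x : ℝ} (h : PhaseSupport 10 x) : (x + 1) * (x - 3) * (x ^ 2 - 3 * x + 1) * (x ^ 2 - x - 1) = 0 := by
  obtain ⟨ζ, hζ, hx⟩ := h
  have hz : ζ ≠ 0 := ne_zero_of_pow_eq_one (by norm_num) hζ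
  have key : ζ ^ 6 * (((x : ℂ) + 1) * ((x : ℂ) - 3) * ((x : ℂ) ^ 2 - 3 * (x : ℂ) + 1) * ((x : ℂ) ^ 2 - (x : ℂ) - 1)) =
      (ζ ^ 2 - 1) * (ζ ^ 10 - 1) := by
    rw [hx]; field_simp; ring
  have := eq_zero_of_unit_mul hz key (by rw [hζ]; ring)
  exact_mod_cast this

/-- The universal certificate polynomial for the icosahedral class: `P = (x+1)(x−2)(x²−3x+1) = x⁴ − 4x³ + 2x² + 5x − 2`. -/
def certPoly : Fin 5 → ℝ := ![-2, 5, 2, -4, 1]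

/-- Factorisation of the certificate quartic: `certPoly = (x + 1)(x − 2)(x² − 3x + 1)`. [docstring added by the census twin] -/
theorem quartic_certPoly (x : ℝ) : quartic certPoly x = (x + 1) * (x - 2) * (x ^ 2 - 3 * x + 1) := by
  simp [quartic, certPoly, Fin.sum_univ_five]; ring

/-- Its Sato–Tate pairing is `−1`. -/
theorem stPairing_certPoly : ∑ j : Fin 5, certPoly j * stMoment j = -1 := by
  simp [certPoly, stMoment, Fin.sum_univ_five]; norm_num

/-- `P ≥ 0` on the phase support of every order `f ≤ 5`. -/
theorem certPoly_nonneg {f : ℕ} (hf1 : 1 ≤ f) (hf5 : f ≤ 5) {x : ℝ} (h : PhaseSupport f x) : 0 ≤ quartic certPoly x := by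
  rw [quartic_certPoly]
  interval_cases f
  · rw [support_one h]; norm_num
  · rcases mul_eq_zero.mp (support_two h) with h | h
    · rw [show x = -1 by linarith]; norm_num
    · rw [show x = 3 by linarith]; norm_num
  · rcases mul_eq_zero.mp (support_three h) with h | h
    · rw [show x = -1 by linarith]; norm_num
    · rw [show x = 2 by linarith]; norm_num
  · rcases mul_eq_zero.mp (support_four h) with h | h
    · rcases mul_eq_zero.mp h with h | h
      · rw [show x = -1 by linarith]; norm_num
      · rw [show x = 1 by linarith]; norm_num
    · rw [show x = 3 by linarith]; norm_num
  · rcases mul_eq_zero.mp (support_five h) with h | h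
    · rw [show x = -1 by linarith]; norm_num
    · rw [h, mul_zero]

/-- **The icosahedral class is moment-rigid.**  Every finite group all of whose element orders are `≤ 5` — `A₅`, `A₆ ≅ PSL₂(9)`,
`2⁴ ⋊ A₅`, … — carries a phase-moment certificate (`P = (x+1)(x−2)(x²−3x+1)`, `κ ≡ 0`): the order spectrum `{1,…,5}` cannot support the
`SO(3)` moment vector `(0,1,1,3)` because `P ≥ 0` on `⋃_{f ≤ 5} V_f` while `∫ P dμ_ST = −1`. -/
theorem cert_of_orderOf_le_five (G : Type*) [Group G] [Finite G] (h : ∀ g : G, orderOf g ≤ 5) : PhaseMomentCertificate G := by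
  refine ⟨certPoly, fun _ => 0, Nat.card_pos, ?_, ?_⟩
  · intro g x hx
    exact certPoly_nonneg (orderOf_pos g) (h g) hx
  · rw [stPairing_certPoly]
    simp only [finsum_zero]
    have : (0 : ℝ) < Nat.card G := by exact_mod_cast Nat.card_pos
    linarith

/-! ### The binary icosahedral class `2·A₅ ≅ SL₂(𝔽₅)` (order spectrum `{1,2,3,4,5,6,10}`; LP margin 0.021 — the certificate needs the class masses) -/

/-- `P⁎ = x⁴ − 5x³ + 5x² + 5x − 5`. -/
def certB : Fin 5 → ℝ := ![-5, 5, 5, -5, 1]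

/-- Expansion of `certB` as the quartic `x⁴ − 5x³ + 5x² + 5x − 5`. [docstring added by the census twin] -/
theorem quartic_certB (x : ℝ) : quartic certB x = x ^ 4 - 5 * x ^ 3 + 5 * x ^ 2 + 5 * x - 5 := by
  simp [quartic, certB, Fin.sum_univ_five]; ring

/-- Sato–Tate pairing of `certB`: `Σ_j certB_j · m_j = −2` for the moments `m = (1,0,1,1,3)`. [docstring added by the census twin] -/
theorem stPairing_certB : ∑ j : Fin 5, certB j * stMoment j = -2 := by
  simp [certB, stMoment, Fin.sum_univ_five]; norm_num

/-- per-order constants of the `SL₂(𝔽₅)` certificate (`s = √5`): `κ₅ = −(3+s)/2`, `κ₆ = −5`, `κ₁₀ = −3(1+s)/2`, else `1`. -/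
def kappaB (s : ℝ) (f : ℕ) : ℝ := if f = 5 then -(3 + s) / 2 else if f = 6 then -5 else if f = 10 then -3 * (1 + s) / 2 else 1

/-- `certB ≥ 1` at the integer phase values `x ∈ {−1, 1, 2, 3}` (the supports of orders `1, 2, 3, 4, 6`). [docstring added by the census twin] -/
theorem certB_ge_one {x : ℝ} (hx : x = -1 ∨ x = 1 ∨ x = 2 ∨ x = 3) : 1 ≤ quartic certB x := by
  rw [quartic_certB]; rcases hx with rfl | rfl | rfl | rfl <;> norm_num

/-- on `x² − 3x + 1 = 0`:  `P⁎(x) = x − 3 ≥ −(3+√5)/2`. -/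
theorem certB_on_phi5 {x s : ℝ} (hs0 : 0 ≤ s) (hs5 : s ^ 2 = 5) (h : x ^ 2 - 3 * x + 1 = 0) : -(3 + s) / 2 ≤ quartic certB x := by
  have hP : quartic certB x = x - 3 := by rw [quartic_certB]; linear_combination (x ^ 2 - 2 * x - 2) * h
  have hroot : (2 * x - 3 - s) * (2 * x - 3 + s) = 0 := by linear_combination 4 * h - hs5
  rw [hP]
  rcases mul_eq_zero.mp hroot with h1 | h1 <;> linarith

/-- on `x² − x − 1 = 0`:  `P⁎(x) = 3x − 3 ≥ −3(1+√5)/2`. -/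
theorem certB_on_phi10 {x s : ℝ} (hs0 : 0 ≤ s) (hs5 : s ^ 2 = 5) (h : x ^ 2 - x - 1 = 0) : -3 * (1 + s) / 2 ≤ quartic certB x := by
  have hP : quartic certB x = 3 * x - 3 := by rw [quartic_certB]; linear_combination (x ^ 2 - 4 * x + 2) * h
  have hroot : (2 * x - 1 - s) * (2 * x - 1 + s) = 0 := by linear_combination 4 * h - hs5
  rw [hP]
  rcases mul_eq_zero.mp hroot with h1 | h1 <;> linarith

/-- The per-order constants `kappaB s f` (`s = √5`) lie below `certB` on the phase support `V_f` for every `f ∈ {1,2,3,4,5,6,10}` — the termwise half of the `SL₂(𝔽₅)` certificate. [docstring added by the census twin] -/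
theorem kappaB_le {s : ℝ} (hs0 : 0 ≤ s) (hs5 : s ^ 2 = 5) {f : ℕ} (hf : f = 1 ∨ f = 2 ∨ f = 3 ∨ f = 4 ∨ f = 5 ∨ f = 6 ∨ f = 10)
    {x : ℝ} (hx : PhaseSupport f x) : kappaB s f ≤ quartic certB x := by
  rcases hf with rfl | rfl | rfl | rfl | rfl | rfl | rfl
  · rw [show kappaB s 1 = 1 by norm_num [kappaB]]
    exact certB_ge_one (Or.inl (support_one hx))
  · rw [show kappaB s 2 = 1 by norm_num [kappaB]]
    rcases mul_eq_zero.mp (support_two hx) with h | h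
    · exact certB_ge_one (Or.inl (by linarith))
    · exact certB_ge_one (Or.inr (Or.inr (Or.inr (by linarith))))
  · rw [show kappaB s 3 = 1 by norm_num [kappaB]]
    rcases mul_eq_zero.mp (support_three hx) with h | h
    · exact certB_ge_one (Or.inl (by linarith))
    · exact certB_ge_one (Or.inr (Or.inr (Or.inl (by linarith))))
  · rw [show kappaB s 4 = 1 by norm_num [kappaB]]
    rcases mul_eq_zero.mp (support_four hx) with h | h
    · rcases mul_eq_zero.mp h with h | h
      · exact certB_ge_one (Or.inl (by linarith))
      · exact certB_ge_one (Or.inr (Or.inl (by linarith)))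
    · exact certB_ge_one (Or.inr (Or.inr (Or.inr (by linarith))))
  · rw [show kappaB s 5 = -(3 + s) / 2 by norm_num [kappaB]]
    rcases mul_eq_zero.mp (support_five hx) with h | h
    · exact le_trans (by nlinarith) (certB_ge_one (Or.inl (by linarith)))
    · exact certB_on_phi5 hs0 hs5 h
  · rw [show kappaB s 6 = -5 by norm_num [kappaB]]
    rcases mul_eq_zero.mp (support_six hx) with h | h
    · rcases mul_eq_zero.mp h with h | h
      · rcases mul_eq_zero.mp h with h | h
        · exact le_trans (by norm_num) (certB_ge_one (Or.inl (by linarith)))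
        · rw [h, quartic_certB]; norm_num
      · exact le_trans (by norm_num) (certB_ge_one (Or.inr (Or.inr (Or.inl (by linarith)))))
    · exact le_trans (by norm_num) (certB_ge_one (Or.inr (Or.inr (Or.inr (by linarith)))))
  · rw [show kappaB s 10 = -3 * (1 + s) / 2 by norm_num [kappaB]]
    rcases mul_eq_zero.mp (support_ten hx) with h | h
    · rcases mul_eq_zero.mp h with h | h
      · rcases mul_eq_zero.mp h with h | h
        · exact le_trans (by nlinarith) (certB_ge_one (Or.inl (by linarith)))
        · exact le_trans (by nlinarith) (certB_ge_one (Or.inr (Or.inr (Or.inr (by linarith)))))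
      · exact le_trans (by nlinarith) (certB_on_phi5 hs0 hs5 h)
    · exact certB_on_phi10 hs0 hs5 h

/-- fibre cardinality as a sum of indicators -/
theorem card_fiber_eq_sum (G : Type*) [Group G] [Fintype G] (f : ℕ) :
    (Nat.card {g : G // orderOf g = f} : ℝ) = ∑ g : G, (if orderOf g = f then (1 : ℝ) else 0) := by
  rw [Finset.sum_boole, Nat.card_eq_fintype_card, Fintype.card_subtype]

/-- **The binary icosahedral class is moment-rigid.**  Every finite group with the ORDER STATISTICS of `SL₂(𝔽₅)` (`|G| = 120`; `24`, `20`, `24`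
elements of order `5`, `6`, `10`; spectrum `{1,2,3,4,5,6,10}`) carries a phase-moment certificate: `P⁎ = x⁴−5x³+5x²+5x−5` (`∫P⁎ dμ_ST = −2`),
`κ = kappaB √5`; the inequality `−240 < −120 − 48√5` is `√5 < 5/2`. -/
theorem cert_of_binaryIcosahedral_stats (G : Type*) [Group G] [Finite G]
    (hord : ∀ g : G, orderOf g = 1 ∨ orderOf g = 2 ∨ orderOf g = 3 ∨ orderOf g = 4 ∨ orderOf g = 5 ∨ orderOf g = 6 ∨ orderOf g = 10)
    (hcard : Nat.card G = 120) (h5 : Nat.card {g : G // orderOf g = 5} = 24) (h6 : Nat.card {g : G // orderOf g = 6} = 20)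
    (h10 : Nat.card {g : G // orderOf g = 10} = 24) : PhaseMomentCertificate G := by
  haveI := Fintype.ofFinite G
  set s := Real.sqrt 5 with hs
  have hs0 : 0 ≤ s := Real.sqrt_nonneg 5
  have hs5 : s ^ 2 = 5 := Real.sq_sqrt (by norm_num)
  refine ⟨certB, kappaB s, by rw [hcard]; norm_num, fun g x hx => kappaB_le hs0 hs5 (hord g) hx, ?_⟩
  have hdec : ∀ g : G, kappaB s (orderOf g) = 1 - (5 + s) / 2 * (if orderOf g = 5 then (1 : ℝ) else 0)
      - 6 * (if orderOf g = 6 then (1 : ℝ) else 0) - (5 + 3 * s) / 2 * (if orderOf g = 10 then (1 : ℝ) else 0) := by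
    intro g
    rcases hord g with h | h | h | h | h | h | h <;> rw [h] <;> norm_num [kappaB] <;> ring
  rw [finsum_eq_sum_of_fintype, Finset.sum_congr rfl (fun g _ => hdec g)]
  simp only [Finset.sum_sub_distrib, ← Finset.mul_sum, ← card_fiber_eq_sum, Finset.sum_const, Finset.card_univ, nsmul_eq_mul, mul_one,
    h5, h6, h10, stPairing_certB]
  rw [← Nat.card_eq_fintype_card, hcard]
  push_cast
  nlinarith [hs5, hs0]

/-! ### The Galois side of the phase: powers of an induced Frobenius -/

/-- **Where the phase comes from.**  At a place `v` inert in `M` the candidate `ρ₀ ≅ Ind χ₀` has eigenvalues `{γ, −γ}` (antidiagonal; g33 kernel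
`trace_antidiagonal`/`det_antidiagonal`), and the relative relation through a place `w | v` of `L` of residue degree `f` only says
`{t₁^f, t₂^f} = {γ^f, (−γ)^f}`.  Hence `ζ := −t₁/t₂` is an `f`-th root of unity and the adjoint trace is `1 − ζ − ζ⁻¹ ∈ V_f`
(and `|t₁| = |t₂|`: with `|t₁t₂| = 1` the place is TEMPERED — the fact that makes the prime-power tails of (a′) harmless).  `t₂ ≠ 0` holds for
Satake parameters (`t₁t₂ = ω(ϖ)`); the formal identity does not even need it. -/
theorem phase_of_powers {t₁ t₂ γ : ℂ} {f : ℕ} (hγ : γ ≠ 0)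
    (h : (t₁ ^ f = γ ^ f ∧ t₂ ^ f = (-γ) ^ f) ∨ (t₁ ^ f = (-γ) ^ f ∧ t₂ ^ f = γ ^ f)) :
    ∃ ζ : ℂ, ζ ^ f = 1 ∧ t₁ / t₂ + 1 + t₂ / t₁ = 1 - ζ - ζ⁻¹ := by
  refine ⟨-(t₁ / t₂), ?_, ?_⟩
  · have e : (-(t₁ / t₂)) ^ f = (-1) ^ f * t₁ ^ f / t₂ ^ f := by rw [neg_pow, div_pow, mul_div_assoc]
    have hn : (-γ) ^ f = (-1) ^ f * γ ^ f := neg_pow γ f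
    have h1 : ((-1 : ℂ)) ^ f * (-1) ^ f = 1 := by rw [← mul_pow]; norm_num
    rcases h with ⟨ha, hb⟩ | ⟨ha, hb⟩
    · rw [e, ha, hb, hn]
      exact div_self (mul_ne_zero (pow_ne_zero _ (neg_ne_zero.mpr one_ne_zero)) (pow_ne_zero _ hγ))
    · rw [e, ha, hb, hn, ← mul_assoc, h1, one_mul]
      exact div_self (pow_ne_zero _ hγ)
  · simp only [inv_neg, inv_div, sub_neg_eq_add]; ring

/-- **Clebsch–Gordan at degree 4**: the normalised `Sym⁴` trace `Y = u² + u + 1 + u⁻¹ + u⁻²` is `X² − X − 1` in the adjoint trace `X = u + 1 + u⁻¹`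
(`u = t₁/t₂`) — so the `GL₅` form `A⁴π = Sym⁴π ⊗ ω⁻²` contributes exactly the moments of degree `3, 4` and nothing of degree `≥ 5` is available
(bc9: the ceiling of the lever is `Sym⁴`, Kim 2003). -/
theorem sym4Trace_eq (u : ℂ) (hu : u ≠ 0) :
    u ^ 2 + u + 1 + u⁻¹ + u⁻¹ ^ 2 = (u + 1 + u⁻¹) ^ 2 - (u + 1 + u⁻¹) - 1 := by
  field_simp; ring

/-- **The moments are read off six pole orders.**  Writing `m_j` for the inert-normalised Dirichlet-density mean of `X^j`, the Jacquet–Shalika pole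
orders of the six `η`-differenced Rankin–Selberg logarithms `(Π, Π') ∈ {1, ad π, A⁴π}²` say `E[1] = 1`, `E[X] = 0`, `E[X²] = 1`, `E[Y] = 0`,
`E[XY] = 0`, `E[Y²] = 1` with `Y = X² − X − 1`; these force `(m₀,…,m₄) = (1, 0, 1, 1, 3) = stMoment` (and `E[Y] = 0` is then a consistency check). -/
theorem stMoment_of_poles (m : Fin 5 → ℝ) (h11 : m 0 = 1) (hX1 : m 1 = 0) (hXX : m 2 = 1)
    (hYX : m 3 - m 2 - m 1 = 0) (hYY : m 4 - 2 * m 3 - m 2 + 2 * m 1 + m 0 = 1) : m = stMoment := by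
  ext j; fin_cases j <;> simp [stMoment] <;> linarith

/-- The sixth pole order (`A⁴π × 1`: no pole, `E[Y] = 0`) is implied by the others — the bookkeeping is consistent. -/
theorem pole_Y1_consistent (m : Fin 5 → ℝ) (h11 : m 0 = 1) (hX1 : m 1 = 0) (hXX : m 2 = 1) : m 2 - m 1 - m 0 = 0 := by
  rw [h11, hX1, hXX]; norm_num

/-- **The certificate contradicts the moments** (the one-line logic of (a′), abstractly): if a mean `E` on pairs (order, value) is monotone and
linear in the way used — here packaged as the two numbers it produces — a certificate is absurd.  Concretely: `lower ≤ upper` (termwise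
`κ_f ≤ P` integrated) is incompatible with `upper < lower` (the certificate inequality read through `E[P(X)] = Σ p_j m_j` and Chebotarev). -/
theorem certificate_absurd {upper lower : ℝ} (hmono : lower ≤ upper) (hcert : upper < lower) : False :=
  absurd hcert (not_lt.mpr hmono)

end Heart

end Summit.Langlands.Langlands.Theorems.PhaseMomentSplit
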